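import Summits.Ventures.HodgeRepro2.T5SU11RadialGreenImproperStable

/-!
# Global bounds for the basis and the weighted head / tail integrals of the improper Green's operator

For `λ > 1` the basis `φ_λ, χ_λ` of the radial equation satisfies GLOBAL exponential bounds — `φ_λ(s) ≤ c₁ e^{(λ−2)s}`
for all `s ≥ 0` (`exists_sph_hyp_le_exp`: row 447's eventual bound and compactness) and `χ_λ(s) ≤ c₂ e^{−λ s}` for
all `s ≥ 1` (`exists_sphDecay_le_exp`). For a source `g` continuous on `(0, ∞)` with a GLOBAL weighted bound
`|g(s)| ≤ N e^{−εs}`, `2 − λ < ε < λ`, the two halves of `G^I_λ g = −χ_λ B^I − φ_λ A^I` (row 492) then satisfy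

* `|B^I(t)| ≤ (c₁ N/(2(λ − ε))) e^{(λ−ε)t}` for `t ≥ 0` (`abs_greenBI_le_weighted`; `sinh 2s ≤ e^{2s}/2` and the
  exact exponential integral `∫_{(0,t]} e^{κs} ≤ e^{κt}/κ`),
* `|A^I(t)| ≤ (c₂ N/(2(λ + ε − 2))) e^{−(λ+ε−2)t}` for `t ≥ 1` (`abs_greenAI_le_weighted`),

so that **`|G^I_λ g(t)| ≤ c₁ c₂ (1/(2(λ−ε)) + 1/(2(λ+ε−2))) N e^{−εt}` for `t ≥ 1`**
(`abs_greenSolI_le_weighted_of_one_le`) with NO loss of rate — the loss in row 499 came from the crude bound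
`(1 + t)` of the head integral and disappears for `ε < λ`. The bound near the origin and the uniform operator bound
are the next row. Nothing is claimed about (N).

Blind lane: Mathlib + the HodgeRepro2 prefix only; no sorry; axioms ⊆ {propext, Classical.choice,
Quot.sound}.
-/

namespace Summit.Ventures.HodgeRepro2.T5SU11ResolventWeightedBasis

open Filter Topology MeasureTheory intervalIntegral
open Set (Ioi Ioc Icc)
open T5SU11Cartan T5SU11SphericalFunction T5SU11SphericalBounds T5SU11SphericalContinuous
  T5SU11SphericalSolutionSpaceAll T5SU11SphericalAsymptotic T5SU11SphericalCfun T5SU11SphericalDecay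
  T5SU11SphericalDecayAsymptotic T5SU11SphericalDecayBracket T5SU11ResolventBoundary T5SU11ReductionOfOrder T5SU11ReductionOfOrderInfinity
  T5SU11RadialGreenImproper T5SU11RadialGreenImproperOrigin T5SU11ResolventSourceIntegrable
  T5SU11RadialGreenImproperDecaySource T5SU11RadialGreenImproperStable

/-! ### Elementary bounds -/

/-- `sinh x ≤ e^x / 2`. -/
theorem sinh_le_exp_div_two (x : ℝ) : Real.sinh x ≤ Real.exp x / 2 := by
  rw [Real.sinh_eq]
  have := Real.exp_pos (-x)
  linarith

/-- `∫_{(0,t]} e^{κ s} ds ≤ e^{κ t}/κ` for `κ > 0`, `t ≥ 0`. -/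
theorem integral_exp_mul_Ioc_le {κ : ℝ} (hκ : 0 < κ) {t : ℝ} (ht : 0 ≤ t) :
    ∫ s in Ioc 0 t, Real.exp (κ * s) ≤ Real.exp (κ * t) / κ := by
  rw [← intervalIntegral.integral_of_le ht]
  have hκ' : κ ≠ 0 := hκ.ne'
  have hderiv : ∀ x ∈ Set.uIcc (0 : ℝ) t, HasDerivAt (fun s => Real.exp (κ * s) / κ) (Real.exp (κ * x)) x := by
    intro x _
    exact (((hasDerivAt_id' x).const_mul κ).exp.div_const κ).congr_deriv (by field_simp)
  rw [integral_eq_sub_of_hasDerivAt hderiv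
    ((Real.continuous_exp.comp (continuous_const.mul continuous_id)).intervalIntegrable _ _)]
  have := Real.exp_pos (κ * 0)
  rw [div_sub_div_same]
  apply div_le_div_of_nonneg_right _ hκ.le
  linarith

section measure

variable [MeasurableSpace Circle] [BorelSpace Circle]

/-! ### Global bounds for the basis -/

/-- **`φ_λ(a_s) ≤ c₁ e^{(λ−2)s}` for all `s ≥ 0`**, `λ > 1`. -/
theorem exists_sph_hyp_le_exp {lam : ℝ} (hlam : 1 < lam) :
    ∃ c₁ : ℝ, 0 < c₁ ∧ ∀ s, 0 ≤ s → sph lam (hyp s) ≤ c₁ * Real.exp ((lam - 2) * s) := by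
  obtain ⟨T₀, hT₀⟩ := eventually_atTop.mp (eventually_sph_hyp_le hlam)
  set T₁ := max T₀ 0 with hT₁
  obtain ⟨s₁, _, hmax⟩ := isCompact_Icc.exists_isMaxOn (Set.nonempty_Icc.mpr (le_max_right T₀ 0))
    (continuous_sph_hyp lam).continuousOn
  set Φ := sph lam (hyp s₁) with hΦ
  have hΦpos : 0 < Φ := sph_hyp_pos lam s₁
  have hc : 0 < cfun (2 - lam) := cfun_pos (by linarith)
  refine ⟨2 * cfun (2 - lam) + Φ * Real.exp (|lam - 2| * T₁), by positivity, fun s hs => ?_⟩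
  have hE : 0 < Real.exp ((lam - 2) * s) := Real.exp_pos _
  rcases le_or_gt T₀ s with h | h
  · calc sph lam (hyp s) ≤ 2 * cfun (2 - lam) * Real.exp ((lam - 2) * s) := hT₀ s h
      _ ≤ (2 * cfun (2 - lam) + Φ * Real.exp (|lam - 2| * T₁)) * Real.exp ((lam - 2) * s) := by
          apply mul_le_mul_of_nonneg_right _ hE.le
          have : 0 ≤ Φ * Real.exp (|lam - 2| * T₁) := by positivity
          linarith
  · have hs1 : s ≤ T₁ := le_trans h.le (le_max_left _ _)
    have hmem : s ∈ Icc 0 T₁ := ⟨hs, hs1⟩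
    have h1 : sph lam (hyp s) ≤ Φ := (isMaxOn_iff.mp hmax) s hmem
    -- `e^{(λ−2)s} e^{|λ−2| T₁} ≥ 1`
    have h2 : 1 ≤ Real.exp ((lam - 2) * s) * Real.exp (|lam - 2| * T₁) := by
      rw [← Real.exp_add]
      apply Real.one_le_exp
      have ha : -(|lam - 2| * s) ≤ (lam - 2) * s := by
        rw [← neg_mul]
        exact mul_le_mul_of_nonneg_right (neg_abs_le _) hs
      have hb : |lam - 2| * s ≤ |lam - 2| * T₁ := mul_le_mul_of_nonneg_left hs1 (abs_nonneg _)
      linarith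
    calc sph lam (hyp s) ≤ Φ := h1
      _ = Φ * 1 := (mul_one Φ).symm
      _ ≤ Φ * (Real.exp ((lam - 2) * s) * Real.exp (|lam - 2| * T₁)) := mul_le_mul_of_nonneg_left h2 hΦpos.le
      _ = Φ * Real.exp (|lam - 2| * T₁) * Real.exp ((lam - 2) * s) := by ring
      _ ≤ (2 * cfun (2 - lam) + Φ * Real.exp (|lam - 2| * T₁)) * Real.exp ((lam - 2) * s) := by
          apply mul_le_mul_of_nonneg_right _ hE.le
          linarith

/-- `χ_λ` is continuous on `(0, ∞)`. -/
theorem continuousOn_sphDecay {lam : ℝ} (hlam : 1 < lam) : ContinuousOn (sphDecay lam) (Ioi 0) :=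
  fun _ ht => (hasDerivAt_sphDecay hlam ht).continuousAt.continuousWithinAt

/-- **`χ_λ(s) ≤ c₂ e^{−λ s}` for all `s ≥ 1`**, `λ > 1`. -/
theorem exists_sphDecay_le_exp {lam : ℝ} (hlam : 1 < lam) :
    ∃ c₂ : ℝ, 0 < c₂ ∧ ∀ s, 1 ≤ s → sphDecay lam s ≤ c₂ * Real.exp (-lam * s) := by
  obtain ⟨T₀, hT₀⟩ := eventually_atTop.mp (eventually_sphDecay_le hlam)
  set T₁ := max T₀ 1 with hT₁
  have hsub : Icc (1 : ℝ) T₁ ⊆ Ioi 0 := fun s hs => lt_of_lt_of_le one_pos hs.1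
  obtain ⟨s₁, hs₁, hmax⟩ := isCompact_Icc.exists_isMaxOn (Set.nonempty_Icc.mpr (le_max_right T₀ 1))
    ((continuousOn_sphDecay hlam).mono hsub)
  set X := sphDecay lam s₁ with hX
  have hXpos : 0 < X := sphDecay_pos hlam (hsub hs₁)
  have hL : 0 < 1 / ((lam - 1) * cfun (2 - lam)) := sphDecay_limit_pos hlam
  refine ⟨2 * (1 / ((lam - 1) * cfun (2 - lam))) + X * Real.exp (lam * T₁), by positivity, fun s hs => ?_⟩
  have hE : 0 < Real.exp (-lam * s) := Real.exp_pos _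
  rcases le_or_gt T₀ s with h | h
  · calc sphDecay lam s ≤ 2 * (1 / ((lam - 1) * cfun (2 - lam))) * Real.exp (-lam * s) := hT₀ s h
      _ ≤ (2 * (1 / ((lam - 1) * cfun (2 - lam))) + X * Real.exp (lam * T₁)) * Real.exp (-lam * s) := by
          apply mul_le_mul_of_nonneg_right _ hE.le
          have : 0 ≤ X * Real.exp (lam * T₁) := by positivity
          linarith
  · have hs1 : s ≤ T₁ := le_trans h.le (le_max_left _ _)
    have h1 : sphDecay lam s ≤ X := (isMaxOn_iff.mp hmax) s ⟨hs, hs1⟩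
    have h2 : 1 ≤ Real.exp (-lam * s) * Real.exp (lam * T₁) := by
      rw [← Real.exp_add]
      apply Real.one_le_exp
      nlinarith
    calc sphDecay lam s ≤ X := h1
      _ = X * 1 := (mul_one X).symm
      _ ≤ X * (Real.exp (-lam * s) * Real.exp (lam * T₁)) := mul_le_mul_of_nonneg_left h2 hXpos.le
      _ = X * Real.exp (lam * T₁) * Real.exp (-lam * s) := by ring
      _ ≤ (2 * (1 / ((lam - 1) * cfun (2 - lam))) + X * Real.exp (lam * T₁)) * Real.exp (-lam * s) := by
          apply mul_le_mul_of_nonneg_right _ hE.le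
          linarith

/-! ### The weighted source class -/

variable {lam ε : ℝ} (hlam : 1 < lam) (hε₁ : 2 - lam < ε) (hε₂ : ε < lam)
  {g : ℝ → ℝ} (hg : ContinuousOn g (Ioi 0)) {N : ℝ} (hN0 : 0 ≤ N)
  (hN : ∀ s, 0 < s → |g s| ≤ N * Real.exp (-ε * s))

omit [MeasurableSpace Circle] [BorelSpace Circle] in
include hN in
/-- A globally weighted source is bounded by `N e^{|ε|}` on `(0, 1]`. -/
theorem abs_le_of_weighted : ∀ s ∈ Ioc (0 : ℝ) 1, |g s| ≤ N * Real.exp |ε| := by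
  intro s hs
  have hN' : 0 ≤ N := by
    have := hN s hs.1
    have := abs_nonneg (g s)
    have := Real.exp_pos (-ε * s)
    nlinarith
  calc |g s| ≤ N * Real.exp (-ε * s) := hN s hs.1
    _ ≤ N * Real.exp |ε| := by
        apply mul_le_mul_of_nonneg_left _ hN'
        apply Real.exp_le_exp.mpr
        have h1 : -ε * s ≤ |ε| * s := mul_le_mul_of_nonneg_right (by rw [← abs_neg]; exact le_abs_self _) hs.1.le
        have h2 : |ε| * s ≤ |ε| := by
          have := mul_le_mul_of_nonneg_left hs.2 (abs_nonneg ε)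
          linarith
        linarith

omit [MeasurableSpace Circle] [BorelSpace Circle] in
include hN in
/-- A globally weighted source satisfies row 496's tail hypothesis with `s₀ = 1`. -/
theorem abs_le_exp_of_weighted : ∀ s, (1 : ℝ) ≤ s → |g s| ≤ N * Real.exp (-ε * s) :=
  fun s hs => hN s (lt_of_lt_of_le one_pos hs)

include hg hN0 hN in
/-- `|φ_λ g sinh 2s|` is integrable on every `(0, t]`. -/
theorem integrableOn_abs_sph_mul_weighted (t : ℝ) :
    IntegrableOn (fun s => |sph lam (hyp s) * g s * Real.sinh (2 * s)|) (Ioc 0 t) :=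
  (integrableOn_sph_mul_mul_sinh_Ioc hg (abs_le_of_weighted hN) (by positivity) lam t).abs

include hlam hε₁ hg hN0 hN in
/-- `|χ_λ g sinh 2s|` is integrable on `(0, ∞)`. -/
theorem integrableOn_abs_sphDecay_mul_weighted :
    IntegrableOn (fun s => |sphDecay lam s * g s * Real.sinh (2 * s)|) (Ioi 0) :=
  (integrableOn_sphDecay_mul_mul_sinh hlam hg (abs_le_of_weighted hN) (by positivity) hε₁
    (abs_le_exp_of_weighted hN)).abs

/-! ### The head and the tail integrals, weighted -/

include hε₂ hg hN0 hN in
/-- **`|B^I(t)| ≤ (c₁ N/(2(λ − ε))) e^{(λ−ε)t}`** for `t ≥ 0`, where `φ_λ ≤ c₁ e^{(λ−2)s}` on `[0, ∞)`. -/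
theorem abs_greenBI_le_weighted {c₁ : ℝ} (hc₁ : 0 < c₁)
    (hφ : ∀ s, 0 ≤ s → sph lam (hyp s) ≤ c₁ * Real.exp ((lam - 2) * s)) {t : ℝ} (ht : 0 ≤ t) :
    |greenBI (fun t => sph lam (hyp t)) g t| ≤ c₁ * N / (2 * (lam - ε)) * Real.exp ((lam - ε) * t) := by
  have hκ : 0 < lam - ε := by linarith
  unfold greenBI
  calc |∫ s in Ioc 0 t, sph lam (hyp s) * g s * Real.sinh (2 * s)|
      ≤ ∫ s in Ioc 0 t, |sph lam (hyp s) * g s * Real.sinh (2 * s)| := by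
        have := norm_integral_le_integral_norm (μ := volume.restrict (Ioc 0 t))
          (fun s => sph lam (hyp s) * g s * Real.sinh (2 * s))
        simpa only [Real.norm_eq_abs] using this
    _ ≤ ∫ s in Ioc 0 t, c₁ * N / 2 * Real.exp ((lam - ε) * s) := by
        have hI : IntegrableOn (fun s => c₁ * N / 2 * Real.exp ((lam - ε) * s)) (Ioc 0 t) :=
          Continuous.integrableOn_Ioc (by fun_prop)
        apply setIntegral_mono_on (integrableOn_abs_sph_mul_weighted hg hN0 hN t) hI measurableSet_Ioc
        intro s hs
        have hs0 : 0 < s := hs.1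
        have hsinh : 0 ≤ Real.sinh (2 * s) := Real.sinh_nonneg_iff.mpr (by linarith)
        rw [abs_mul, abs_mul, abs_of_pos (sph_hyp_pos lam s), abs_of_nonneg hsinh]
        have hE : Real.exp ((lam - ε) * s) = Real.exp ((lam - 2) * s) * Real.exp (-ε * s) * Real.exp (2 * s) := by
          rw [← Real.exp_add, ← Real.exp_add]; congr 1; ring
        rw [hE]
        have h1 := hφ s hs0.le
        have h2 := hN s hs0
        have h3 := sinh_le_exp_div_two (2 * s)
        have hE1 : 0 ≤ Real.exp ((lam - 2) * s) := (Real.exp_pos _).le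
        have hE2 : 0 ≤ Real.exp (-ε * s) := (Real.exp_pos _).le
        calc sph lam (hyp s) * |g s| * Real.sinh (2 * s)
            ≤ (c₁ * Real.exp ((lam - 2) * s)) * (N * Real.exp (-ε * s)) * (Real.exp (2 * s) / 2) :=
              mul_le_mul (mul_le_mul h1 h2 (abs_nonneg _) (by positivity)) h3 hsinh (by positivity)
          _ = c₁ * N / 2 * (Real.exp ((lam - 2) * s) * Real.exp (-ε * s) * Real.exp (2 * s)) := by ring
    _ = c₁ * N / 2 * ∫ s in Ioc 0 t, Real.exp ((lam - ε) * s) := integral_const_mul _ _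
    _ ≤ c₁ * N / 2 * (Real.exp ((lam - ε) * t) / (lam - ε)) :=
        mul_le_mul_of_nonneg_left (integral_exp_mul_Ioc_le hκ ht) (by positivity)
    _ = c₁ * N / (2 * (lam - ε)) * Real.exp ((lam - ε) * t) := by
        field_simp

include hlam hε₁ hg hN0 hN in
/-- **`|A^I(t)| ≤ (c₂ N/(2(λ + ε − 2))) e^{−(λ+ε−2)t}`** for `t ≥ 1`, where `χ_λ ≤ c₂ e^{−λ s}` on `[1, ∞)`. -/
theorem abs_greenAI_le_weighted {c₂ : ℝ} (hc₂ : 0 < c₂)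
    (hχ : ∀ s, 1 ≤ s → sphDecay lam s ≤ c₂ * Real.exp (-lam * s)) {t : ℝ} (ht : 1 ≤ t) :
    |greenAI (sphDecay lam) g t| ≤ c₂ * N / (2 * (lam + ε - 2)) * Real.exp (-(lam + ε - 2) * t) := by
  have hκ : 0 < lam + ε - 2 := by linarith
  have ht0 : 0 < t := lt_of_lt_of_le one_pos ht
  unfold greenAI
  calc |∫ s in Ioi t, sphDecay lam s * g s * Real.sinh (2 * s)|
      ≤ ∫ s in Ioi t, |sphDecay lam s * g s * Real.sinh (2 * s)| := by
        have := norm_integral_le_integral_norm (μ := volume.restrict (Ioi t))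
          (fun s => sphDecay lam s * g s * Real.sinh (2 * s))
        simpa only [Real.norm_eq_abs] using this
    _ ≤ ∫ s in Ioi t, c₂ * N / 2 * Real.exp (-(lam + ε - 2) * s) := by
        have hI : IntegrableOn (fun s => c₂ * N / 2 * Real.exp (-(lam + ε - 2) * s)) (Ioi t) :=
          (exp_neg_integrableOn_Ioi t hκ).const_mul _
        apply setIntegral_mono_on
          ((integrableOn_abs_sphDecay_mul_weighted hlam hε₁ hg hN0 hN).mono_set (Set.Ioi_subset_Ioi ht0.le))
          hI measurableSet_Ioi
        intro s hs
        have hs1 : 1 ≤ s := le_trans ht (le_of_lt hs)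
        have hs0 : 0 < s := lt_of_lt_of_le one_pos hs1
        have hsinh : 0 ≤ Real.sinh (2 * s) := Real.sinh_nonneg_iff.mpr (by linarith)
        rw [abs_mul, abs_mul, abs_of_pos (sphDecay_pos hlam hs0), abs_of_nonneg hsinh]
        have hE : Real.exp (-(lam + ε - 2) * s) = Real.exp (-lam * s) * Real.exp (-ε * s) * Real.exp (2 * s) := by
          rw [← Real.exp_add, ← Real.exp_add]; congr 1; ring
        rw [hE]
        have h1 := hχ s hs1
        have h2 := hN s hs0
        have h3 := sinh_le_exp_div_two (2 * s)
        have hE1 : 0 ≤ Real.exp (-lam * s) := (Real.exp_pos _).le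
        have hE2 : 0 ≤ Real.exp (-ε * s) := (Real.exp_pos _).le
        calc sphDecay lam s * |g s| * Real.sinh (2 * s)
            ≤ (c₂ * Real.exp (-lam * s)) * (N * Real.exp (-ε * s)) * (Real.exp (2 * s) / 2) :=
              mul_le_mul (mul_le_mul h1 h2 (abs_nonneg _) (by positivity)) h3 hsinh (by positivity)
          _ = c₂ * N / 2 * (Real.exp (-lam * s) * Real.exp (-ε * s) * Real.exp (2 * s)) := by ring
    _ = c₂ * N / 2 * ∫ s in Ioi t, Real.exp (-(lam + ε - 2) * s) := integral_const_mul _ _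
    _ = c₂ * N / 2 * (Real.exp (-(lam + ε - 2) * t) / (lam + ε - 2)) := by
        rw [integral_exp_neg_mul_Ioi hκ]
    _ = c₂ * N / (2 * (lam + ε - 2)) * Real.exp (-(lam + ε - 2) * t) := by
        field_simp

include hlam hε₁ hε₂ hg hN0 hN in
/-- **`|G^I_λ g(t)| ≤ c₁ c₂ (1/(2(λ−ε)) + 1/(2(λ+ε−2))) N e^{−εt}` for `t ≥ 1`** — no loss of rate. -/
theorem abs_greenSolI_le_weighted_of_one_le {c₁ c₂ : ℝ} (hc₁ : 0 < c₁) (hc₂ : 0 < c₂)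
    (hφ : ∀ s, 0 ≤ s → sph lam (hyp s) ≤ c₁ * Real.exp ((lam - 2) * s))
    (hχ : ∀ s, 1 ≤ s → sphDecay lam s ≤ c₂ * Real.exp (-lam * s)) {t : ℝ} (ht : 1 ≤ t) :
    |greenSolI (fun t => sph lam (hyp t)) (sphDecay lam) g t|
      ≤ c₁ * c₂ * (1 / (2 * (lam - ε)) + 1 / (2 * (lam + ε - 2))) * N * Real.exp (-ε * t) := by
  have ht0 : 0 < t := lt_of_lt_of_le one_pos ht
  have hB := abs_greenBI_le_weighted hε₂ hg hN0 hN hc₁ hφ ht0.le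
  have hA := abs_greenAI_le_weighted hlam hε₁ hg hN0 hN hc₂ hχ ht
  have hφt := hφ t ht0.le
  have hχt := hχ t ht
  have hφ0 : 0 < sph lam (hyp t) := sph_hyp_pos lam t
  have hχ0 : 0 < sphDecay lam t := sphDecay_pos hlam ht0
  have hκ₁ : 0 < lam - ε := by linarith
  have hκ₂ : 0 < lam + ε - 2 := by linarith
  unfold greenSolI
  have e1 : Real.exp (-lam * t) * Real.exp ((lam - ε) * t) = Real.exp (-ε * t) := by
    rw [← Real.exp_add]; congr 1; ring
  have e2 : Real.exp ((lam - 2) * t) * Real.exp (-(lam + ε - 2) * t) = Real.exp (-ε * t) := by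
    rw [← Real.exp_add]; congr 1; ring
  calc |-(sphDecay lam t * greenBI (fun t => sph lam (hyp t)) g t) - sph lam (hyp t) * greenAI (sphDecay lam) g t|
      ≤ |-(sphDecay lam t * greenBI (fun t => sph lam (hyp t)) g t)|
          + |sph lam (hyp t) * greenAI (sphDecay lam) g t| := abs_sub _ _
    _ = sphDecay lam t * |greenBI (fun t => sph lam (hyp t)) g t|
          + sph lam (hyp t) * |greenAI (sphDecay lam) g t| := by
          rw [abs_neg, abs_mul, abs_mul, abs_of_pos hχ0, abs_of_pos hφ0]
    _ ≤ (c₂ * Real.exp (-lam * t)) * (c₁ * N / (2 * (lam - ε)) * Real.exp ((lam - ε) * t))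
          + (c₁ * Real.exp ((lam - 2) * t)) * (c₂ * N / (2 * (lam + ε - 2)) * Real.exp (-(lam + ε - 2) * t)) :=
          add_le_add (mul_le_mul hχt hB (abs_nonneg _) (by positivity))
            (mul_le_mul hφt hA (abs_nonneg _) (by positivity))
    _ = c₁ * c₂ * (1 / (2 * (lam - ε))) * N * (Real.exp (-lam * t) * Real.exp ((lam - ε) * t))
          + c₁ * c₂ * (1 / (2 * (lam + ε - 2))) * N * (Real.exp ((lam - 2) * t) * Real.exp (-(lam + ε - 2) * t)) := by
          ring
    _ = c₁ * c₂ * (1 / (2 * (lam - ε)) + 1 / (2 * (lam + ε - 2))) * N * Real.exp (-ε * t) := by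
          rw [e1, e2]; ring

end measure

end Summit.Ventures.HodgeRepro2.T5SU11ResolventWeightedBasis
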